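import Literature.AlgebraicGeometry.HodgeTheory.HypersurfaceTransversalLine
import Mathlib.RingTheory.MvPolynomial.Homogeneous
import Mathlib.Algebra.Polynomial.Roots
import HarnessLib

/-!
# Noether normal form of the affine charts of a hypersurface along a transversal coordinate line

Pure algebra feeding the hypotheses of Serre's algebraisation lemma
(`Literature.Analysis.Complex.AffineHypersurface.exists_mvPolynomial_eq_on_hypersurface'`) on the affine charts
`{x_{i₀} ≠ 0}`, `i₀ = i₁ + 1` with `i₁ ≠ 0`, of a form `G` of degree `d` in the normal form of the tree's
`TransversalLine.exists_linSubst_transversal_line` (`G(e₀) ≠ 0`; `t ↦ G(t, 1, 0, …, 0)` has simple roots):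

* `finSuccEquiv_dehomogenisation_coeff` — the family of the dehomogenisation `h = G(x_{i₀} = 1)` in the variable
  `t = x₀` is the dehomogenisation of the family of `G`: `a_j(h) = a_j(G)(x_{i₁} = 1)`;
* `homogeneousComponent_aeval_insertNth_one` — the top-degree component of a dehomogenisation is the restriction
  to the hyperplane at infinity: `(R(x_i = 1))_{(e)} = R(x_i = 0)` for `R` homogeneous of degree `e`;
* `finSuccEquiv_homogeneousComponent_coeff` — `a_j(h_{(d)}) = (a_j(h))_{(d-j)}`;
* `normalForm_lead` — the coefficient of `t^d` in the family of `h` is the constant `G(e₀)`;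
* `normalForm_topFamily_roots_nodup` — the fibre of the top-degree family of `h` over `w₀ = e₀ ∈ ℂ^m` is
  `t ↦ G(t, 1, 0, …, 0)`, whose roots are simple, hence distinct.

Provenance: Literature home (namespace `Literature.AlgebraicGeometry.HodgeTheory.HypersurfaceTopForms`) of the Summits-side `Theorems/SmoothHypersurfaceNormalFormCharts` (cell `hodge-nonav`, programme PG-GENERAL, prover seat `hodge-nonav-prover-Bx` g11; all its imports are `Literature/` and Mathlib), part of the seven-file chain proving Griffiths' description of the holomorphic top forms of a smooth hypersurface (`h^{n,0}(X_F) = C(d-1, n+1)`); theorems only, no named fact, no definition. Lane `lit-hodgefound` (Layer A1: Hodge theory of hypersurfaces), seat p20.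
-/

noncomputable section

open Polynomial Finset

namespace Literature.AlgebraicGeometry.HodgeTheory.HypersurfaceTopForms.NormalFormCharts

variable {m : ℕ}

/-! ### The family of the dehomogenisation -/

/-- **The family of `h = G(x_{i₁+1} = 1)` in `t = x₀` is the dehomogenisation of the family of `G` in `x₀`**:
`a_j(h) = a_j(G)(x_{i₁} = 1)` (both sides are algebra maps agreeing on the variables). [cite: VoisinHodgeII2003, §6.1.3] -/
theorem finSuccEquiv_dehomogenisation_coeff (G : MvPolynomial (Fin (m + 2)) ℂ) (i₁ : Fin (m + 1)) (j : ℕ) :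
    (MvPolynomial.finSuccEquiv ℂ m
        (MvPolynomial.aeval (Fin.insertNth i₁.succ (1 : MvPolynomial (Fin (m + 1)) ℂ) MvPolynomial.X) G)).coeff j =
      MvPolynomial.aeval (Fin.insertNth i₁ (1 : MvPolynomial (Fin m) ℂ) MvPolynomial.X)
        ((MvPolynomial.finSuccEquiv ℂ (m + 1) G).coeff j) := by
  -- the two algebra maps agree on the variables
  have key : ∀ l : Fin (m + 2),
      MvPolynomial.finSuccEquiv ℂ m ((Fin.insertNth i₁.succ (1 : MvPolynomial (Fin (m + 1)) ℂ) MvPolynomial.X :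
          Fin (m + 2) → MvPolynomial (Fin (m + 1)) ℂ) l) =
        Polynomial.map (MvPolynomial.aeval (Fin.insertNth i₁ (1 : MvPolynomial (Fin m) ℂ) MvPolynomial.X)).toRingHom
          (MvPolynomial.finSuccEquiv ℂ (m + 1) (MvPolynomial.X l)) := by
    intro l
    refine Fin.cases ?_ (fun l₁ ↦ ?_) l
    · rw [show (0 : Fin (m + 2)) = i₁.succ.succAbove 0 from (Fin.succ_succAbove_zero i₁).symm,
        Fin.insertNth_apply_succAbove, Fin.succ_succAbove_zero, MvPolynomial.finSuccEquiv_X_zero,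
        MvPolynomial.finSuccEquiv_X_zero, Polynomial.map_X]
    · rw [MvPolynomial.finSuccEquiv_X_succ, Polynomial.map_C, AlgHom.toRingHom_eq_coe, RingHom.coe_coe,
        MvPolynomial.aeval_X]
      refine Fin.succAboveCases i₁ ?_ (fun j' ↦ ?_) l₁
      · rw [Fin.insertNth_apply_same, map_one, Fin.insertNth_apply_same, map_one]
      · rw [← Fin.succ_succAbove_succ, Fin.insertNth_apply_succAbove, MvPolynomial.finSuccEquiv_X_succ,
          Fin.insertNth_apply_succAbove]
  have hφ : (MvPolynomial.finSuccEquiv ℂ m).toAlgHom.comp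
      (MvPolynomial.aeval (Fin.insertNth i₁.succ (1 : MvPolynomial (Fin (m + 1)) ℂ) MvPolynomial.X)) =
      (Polynomial.mapAlgHom (MvPolynomial.aeval (Fin.insertNth i₁ (1 : MvPolynomial (Fin m) ℂ) MvPolynomial.X))).comp
        (MvPolynomial.finSuccEquiv ℂ (m + 1)).toAlgHom := by
    refine MvPolynomial.algHom_ext fun l ↦ ?_
    simp only [AlgHom.comp_apply, MvPolynomial.aeval_X, Polynomial.coe_mapAlgHom]
    exact key l
  have hG := DFunLike.congr_fun hφ G
  simp only [AlgHom.comp_apply, Polynomial.coe_mapAlgHom] at hG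
  have hG' : MvPolynomial.finSuccEquiv ℂ m
      (MvPolynomial.aeval (Fin.insertNth i₁.succ (1 : MvPolynomial (Fin (m + 1)) ℂ) MvPolynomial.X) G) =
      Polynomial.map (MvPolynomial.aeval (Fin.insertNth i₁ (1 : MvPolynomial (Fin m) ℂ) MvPolynomial.X)).toRingHom
        (MvPolynomial.finSuccEquiv ℂ (m + 1) G) := hG
  rw [hG', Polynomial.coeff_map, AlgHom.toRingHom_eq_coe, RingHom.coe_coe]

/-! ### Top-degree component of a dehomogenisation -/

/-- **The top-degree component of the dehomogenisation of a form is its restriction to the hyperplane at infinity**: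
for `R` homogeneous of degree `e`, `(R(x_i = 1))_{(e)} = R(x_i = 0)` (a monomial `x^μ` keeps degree `e` under
`x_i = 1` iff `μ_i = 0`, which is when it survives `x_i = 0`). [cite: VoisinHodgeII2003, §6.1.3] -/
theorem homogeneousComponent_aeval_insertNth_one {n e : ℕ} {R : MvPolynomial (Fin (n + 1)) ℂ} (hR : R.IsHomogeneous e)
    (i : Fin (n + 1)) :
    MvPolynomial.homogeneousComponent e (MvPolynomial.aeval (Fin.insertNth i (1 : MvPolynomial (Fin n) ℂ)
      MvPolynomial.X) R) = MvPolynomial.aeval (Fin.insertNth i (0 : MvPolynomial (Fin n) ℂ) MvPolynomial.X) R := by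
  classical
  -- reduce to monomials of degree `e`
  conv_lhs => rw [R.as_sum]
  conv_rhs => rw [R.as_sum]
  rw [map_sum, map_sum, map_sum]
  refine Finset.sum_congr rfl fun μ hμ ↦ ?_
  have hdeg : μ.degree = e := by
    rw [Finsupp.degree_eq_weight_one]
    exact hR (MvPolynomial.mem_support_iff.mp hμ)
  -- the monomial after substitution
  have hmon : ∀ a : MvPolynomial (Fin n) ℂ, MvPolynomial.aeval (Fin.insertNth i a MvPolynomial.X)
      (MvPolynomial.monomial μ (MvPolynomial.coeff μ R)) = MvPolynomial.C (MvPolynomial.coeff μ R) * a ^ μ i *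
        ∏ j : Fin n, MvPolynomial.X j ^ μ (i.succAbove j) := by
    intro a
    rw [MvPolynomial.aeval_monomial, MvPolynomial.algebraMap_eq, Finsupp.prod_fintype _ _ (fun l ↦ by simp),
      Fin.prod_univ_succAbove _ i, Fin.insertNth_apply_same, mul_assoc]
    congr 2
    exact Finset.prod_congr rfl fun j _ ↦ by rw [Fin.insertNth_apply_succAbove]
  rw [hmon, hmon, one_pow, mul_one]
  -- the surviving monomial is homogeneous of degree `e - μ i`
  set ν : Fin n →₀ ℕ := Finsupp.equivFunOnFinite.symm fun j ↦ μ (i.succAbove j) with hν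
  have hprod : (∏ j : Fin n, MvPolynomial.X j ^ μ (i.succAbove j) : MvPolynomial (Fin n) ℂ) =
      MvPolynomial.monomial ν 1 := by
    rw [MvPolynomial.monomial_eq, MvPolynomial.C_1, one_mul, Finsupp.prod_fintype _ _ (fun l ↦ by simp)]
    rfl
  have hνdeg : ν.degree + μ i = e := by
    rw [← hdeg, Finsupp.degree_eq_sum, Finsupp.degree_eq_sum, Fin.sum_univ_succAbove _ i, add_comm]
    rfl
  have hmem : MvPolynomial.C (MvPolynomial.coeff μ R) * ∏ j : Fin n, MvPolynomial.X j ^ μ (i.succAbove j) ∈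
      MvPolynomial.homogeneousSubmodule (Fin n) ℂ ν.degree := by
    rw [hprod, MvPolynomial.mem_homogeneousSubmodule, ← MvPolynomial.smul_eq_C_mul, MvPolynomial.smul_monomial,
      smul_eq_mul, mul_one]
    exact MvPolynomial.isHomogeneous_monomial _ rfl
  rw [MvPolynomial.homogeneousComponent_of_mem hmem]
  by_cases h0 : μ i = 0
  · rw [h0, pow_zero, mul_one, if_pos]; omega
  · rw [zero_pow h0, mul_zero, zero_mul, if_neg]; omega

/-- **The family of the top-degree component**: for `h` of total degree `≤ d`,
`a_j(h_{(d)}) = (a_j(h))_{(d-j)}` (a monomial `t^j w^μ` has degree `d` iff `|μ| = d - j`). [cite: VoisinHodgeII2003, §6.1.3] -/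
theorem finSuccEquiv_homogeneousComponent_coeff {d : ℕ} (h : MvPolynomial (Fin (m + 1)) ℂ) (hh : h.totalDegree ≤ d)
    (j : ℕ) :
    (MvPolynomial.finSuccEquiv ℂ m (MvPolynomial.homogeneousComponent d h)).coeff j =
      MvPolynomial.homogeneousComponent (d - j) ((MvPolynomial.finSuccEquiv ℂ m h).coeff j) := by
  classical
  ext μ
  rw [MvPolynomial.finSuccEquiv_coeff_coeff, MvPolynomial.coeff_homogeneousComponent,
    MvPolynomial.coeff_homogeneousComponent, MvPolynomial.finSuccEquiv_coeff_coeff]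
  have hcons : (Finsupp.cons j μ).degree = j + μ.degree := by
    rw [Finsupp.degree_eq_sum, Finsupp.degree_eq_sum, Fin.sum_univ_succ, Finsupp.cons_zero]
    simp [Finsupp.cons_succ]
  rw [hcons]
  by_cases hj : j ≤ d
  · have : j + μ.degree = d ↔ μ.degree = d - j := by omega
    simp only [this]
  · rw [if_neg (by omega)]
    split_ifs with hμ
    · symm
      apply MvPolynomial.coeff_eq_zero_of_totalDegree_lt
      rw [← Finsupp.degree_apply, hcons]
      omega
    · rfl

/-! ### The normal-form data on the charts `{x_{i₁+1} ≠ 0}`, `i₁ ≠ 0` -/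

/-- Evaluating a substitution `x_i ↦ c`, `x_{≠ i} ↦ x`: `(R(x_i = c))(u) = R(u with c(u) inserted in slot i)`. [cite: VoisinHodgeII2003, §6.1.3] -/
theorem eval_aeval_insertNth {n : ℕ} (R : MvPolynomial (Fin (n + 1)) ℂ) (i : Fin (n + 1)) (c : MvPolynomial (Fin n) ℂ)
    (u : Fin n → ℂ) :
    MvPolynomial.eval u (MvPolynomial.aeval (Fin.insertNth i c MvPolynomial.X) R) =
      MvPolynomial.eval (Fin.insertNth i (MvPolynomial.eval u c) u) R := by
  rw [MvPolynomial.aeval_def, MvPolynomial.eval₂_comp_left]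
  have hcomp : (MvPolynomial.eval u).comp (algebraMap ℂ (MvPolynomial (Fin n) ℂ)) = RingHom.id ℂ := by
    ext a; simp
  rw [hcomp]
  unfold MvPolynomial.eval
  rw [MvPolynomial.coe_eval₂Hom]
  congr 1
  funext l
  refine Fin.succAboveCases i ?_ (fun j ↦ ?_) l
  · simp
  · simp only [Function.comp_apply, Fin.insertNth_apply_succAbove, MvPolynomial.eval₂_X]

/-- **The leading coefficient in normal form**: for `G` homogeneous of degree `d`, the coefficient of `t^d` (`t = x₀`)
in the family of the dehomogenisation `h = G(x_{i₁+1} = 1)` is the constant `G(e₀)`. [cite: VoisinHodgeII2003, §6.1.3] -/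
theorem normalForm_lead {d : ℕ} {G : MvPolynomial (Fin (m + 2)) ℂ} (hG : G.IsHomogeneous d) (i₁ : Fin (m + 1)) :
    (MvPolynomial.finSuccEquiv ℂ m
        (MvPolynomial.aeval (Fin.insertNth i₁.succ (1 : MvPolynomial (Fin (m + 1)) ℂ) MvPolynomial.X) G)).coeff d =
      MvPolynomial.C (MvPolynomial.eval (Pi.single (0 : Fin (m + 2)) (1 : ℂ)) G) := by
  rw [finSuccEquiv_dehomogenisation_coeff,
    Literature.AlgebraicGeometry.HodgeTheory.TransversalLine.coeff_finSuccEquiv_eq_C_of_isHomogeneous hG,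
    MvPolynomial.aeval_C, MvPolynomial.algebraMap_eq,
    Literature.AlgebraicGeometry.HodgeTheory.TransversalLine.eval_single_zero_one_of_isHomogeneous hG]

/-- **The fibre at infinity over `e₀` is the transversal line**: for `G` homogeneous of degree `d`, `i₁ ≠ 0`, and
`h = G(x_{i₁+1} = 1)` with family `P`, the top-degree family `Σ_j (a_j)_{(d-j)} X^j` evaluated at
`w₀ = e₀ ∈ ℂ^m` is the polynomial `t ↦ G(t, 1, 0, …, 0)`. [cite: VoisinHodgeII2003, §6.1.3] -/
theorem eval_topFamily_normalForm [NeZero m] {d : ℕ} {G : MvPolynomial (Fin (m + 2)) ℂ} (hG : G.IsHomogeneous d)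
    {i₁ : Fin (m + 1)} (hi₁ : i₁ ≠ 0) (t : ℂ) :
    ((∑ j ∈ Finset.range (d + 1), Polynomial.monomial j
      (MvPolynomial.homogeneousComponent (d - j) ((MvPolynomial.finSuccEquiv ℂ m
        (MvPolynomial.aeval (Fin.insertNth i₁.succ (1 : MvPolynomial (Fin (m + 1)) ℂ) MvPolynomial.X) G)).coeff j))).map
          (MvPolynomial.eval (Pi.single (0 : Fin m) (1 : ℂ)))).eval t =
      MvPolynomial.eval (Fin.cons t (Pi.single (0 : Fin (m + 1)) (1 : ℂ)) : Fin (m + 2) → ℂ) G := by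
  classical
  -- the point `w₀ = e₀` with a `0` inserted in slot `i₁ ≠ 0` is `e₀`
  have hpt : (Fin.insertNth i₁ (0 : ℂ) (Pi.single (0 : Fin m) (1 : ℂ)) : Fin (m + 1) → ℂ) =
      Pi.single (0 : Fin (m + 1)) 1 := by
    funext l
    refine Fin.succAboveCases i₁ ?_ (fun j ↦ ?_) l
    · rw [Fin.insertNth_apply_same, Pi.single_eq_of_ne hi₁]
    · rw [Fin.insertNth_apply_succAbove]
      by_cases hj : j = 0
      · subst hj; rw [Fin.succAbove_ne_zero_zero hi₁, Pi.single_eq_same, Pi.single_eq_same]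
      · rw [Pi.single_eq_of_ne hj, Pi.single_eq_of_ne]
        intro h0
        exact hj (Fin.succAbove_right_injective (h0.trans (Fin.succAbove_ne_zero_zero hi₁).symm))
  -- coefficientwise
  have hcoef : ∀ j ∈ Finset.range (d + 1), MvPolynomial.eval (Pi.single (0 : Fin m) (1 : ℂ))
      (MvPolynomial.homogeneousComponent (d - j) ((MvPolynomial.finSuccEquiv ℂ m
        (MvPolynomial.aeval (Fin.insertNth i₁.succ (1 : MvPolynomial (Fin (m + 1)) ℂ) MvPolynomial.X) G)).coeff j)) =
      MvPolynomial.eval (Pi.single (0 : Fin (m + 1)) (1 : ℂ)) ((MvPolynomial.finSuccEquiv ℂ (m + 1) G).coeff j) := by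
    intro j hj
    have hjd : j ≤ d := Nat.lt_succ_iff.mp (Finset.mem_range.mp hj)
    rw [finSuccEquiv_dehomogenisation_coeff,
      homogeneousComponent_aeval_insertNth_one (hG.finSuccEquiv_coeff_isHomogeneous j (d - j) (by omega)),
      eval_aeval_insertNth, map_zero, hpt]
  rw [Polynomial.eval_map, Polynomial.eval₂_finsetSum]
  simp only [Polynomial.eval₂_monomial]
  rw [Finset.sum_congr rfl fun j hj ↦ by rw [hcoef j hj], MvPolynomial.eval_eq_eval_mv_eval',
    Polynomial.eval_eq_sum_range' (n := d + 1)]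
  · simp only [Polynomial.coeff_map]
  · exact lt_of_le_of_lt (Polynomial.natDegree_map_le.trans
      (Literature.AlgebraicGeometry.HodgeTheory.TransversalLine.natDegree_finSuccEquiv_le_of_isHomogeneous hG))
      (Nat.lt_succ_self d)

/-- **The fibre at infinity has distinct roots in normal form**: with `g(t) = G(t, 1, 0, …, 0)` having only simple
roots (`TransversalLine.exists_linSubst_transversal_line`), the top-degree family of `h = G(x_{i₁+1} = 1)` (`i₁ ≠ 0`) has
distinct roots over `w₀ = e₀` — hypothesis `hsep` of Serre's lemma. [cite: VoisinHodgeII2003, §6.1.3] -/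
theorem normalForm_topFamily_roots_nodup [NeZero m] {d : ℕ} {G : MvPolynomial (Fin (m + 2)) ℂ} (hG : G.IsHomogeneous d)
    {i₁ : Fin (m + 1)} (hi₁ : i₁ ≠ 0) {g : ℂ[X]} (hg0 : g ≠ 0)
    (hg : ∀ t : ℂ, g.eval t = MvPolynomial.eval (Fin.cons t (Pi.single (0 : Fin (m + 1)) (1 : ℂ)) : Fin (m + 2) → ℂ) G)
    (hsimple : ∀ t : ℂ, g.eval t = 0 → (Polynomial.derivative g).eval t ≠ 0) :
    ((∑ j ∈ Finset.range (d + 1), Polynomial.monomial j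
      (MvPolynomial.homogeneousComponent (d - j) ((MvPolynomial.finSuccEquiv ℂ m
        (MvPolynomial.aeval (Fin.insertNth i₁.succ (1 : MvPolynomial (Fin (m + 1)) ℂ) MvPolynomial.X) G)).coeff j))).map
          (MvPolynomial.eval (Pi.single (0 : Fin m) (1 : ℂ)))).roots.Nodup := by
  classical
  have heq : ((∑ j ∈ Finset.range (d + 1), Polynomial.monomial j
      (MvPolynomial.homogeneousComponent (d - j) ((MvPolynomial.finSuccEquiv ℂ m
        (MvPolynomial.aeval (Fin.insertNth i₁.succ (1 : MvPolynomial (Fin (m + 1)) ℂ) MvPolynomial.X) G)).coeff j))).map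
          (MvPolynomial.eval (Pi.single (0 : Fin m) (1 : ℂ)))) = g :=
    Polynomial.funext fun t ↦ by rw [eval_topFamily_normalForm hG hi₁, hg]
  rw [heq, Multiset.nodup_iff_count_le_one]
  intro a
  rw [Polynomial.count_roots]
  by_contra hlt
  have h1 : 1 < g.rootMultiplicity a := by omega
  obtain ⟨hr, hr'⟩ := (Polynomial.one_lt_rootMultiplicity_iff_isRoot hg0).mp h1
  exact hsimple a hr hr'

end Literature.AlgebraicGeometry.HodgeTheory.HypersurfaceTopForms.NormalFormCharts

end
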